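import Mathlib.Analysis.Complex.OperatorNorm
import Literature.MathematicalPhysics.QuantumLattice.SchwartzTensor
import Literature.MathematicalPhysics.QuantumLattice.SchwingerOSAxioms
import HarnessLib

/-!
# Real and imaginary parts of complex test functions

Trunk **T-AQFT** (topic `MathematicalPhysics/QuantumLattice`), families `constructive-qft`,
`crit-ising`; a small tools file for the decomposition of the bridge
`Literature.MathematicalPhysics.QuantumLattice.IsOSMeasure.exists_isOSFamily'` (measure-form OS axioms ⇒ distributional OS axioms).

The moments of a measure on `𝒮'(ℝ^d)` and the reflection-positivity axiom OS3 concern *real*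
test functions, whereas the Schwinger functions are distributions on complex test functions of
several variables. This file provides the bookkeeping between the two:

* `Literature.MathematicalPhysics.QuantumLattice.reTest`, `Literature.MathematicalPhysics.QuantumLattice.imTest`: real and imaginary parts `𝓢(X, ℂ) →L[ℝ] 𝓢(X, ℝ)`
  (Mathlib `SchwartzMap.postcompCLM` of `Complex.reCLM` / `Complex.imCLM`), their supports
  (`tsupport_reTest_subset`, `tsupport_imTest_subset`);
* comparisons of Schwartz norms (`schwartzNorm` of `SchwingerOSAxioms`, OS II §2):
  `|re φ|_s, |im φ|_s ≤ |φ|_s` (`schwartzNorm_ofRealTest_reTest_le`,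
  `schwartzNorm_ofRealTest_imTest_le`), the real seminorms of `f` are those of its
  complexification (`seminorm_le_seminorm_ofRealTest`, `sup_seminorm_le_schwartzNorm`),
  homogeneity `|r f|_s = |r| |f|_s` and `|f|_s = 0 ⇒ f = 0`;
* the expansion of a tensor product of complex one-point functions into `2ⁿ` tensor products of
  real ones, `φ₁ ⊗ ⋯ ⊗ φₙ = ∑_{t ⊆ [n]} i^{n-|t|} ⊗ᵢ ψᵗᵢ`, `ψᵗᵢ ∈ {re φᵢ, im φᵢ}`
  (`eq_sum_tensorFin_reIm`, from `∏ᵢ (aᵢ + bᵢ) = ∑_t ∏_{i∈t} aᵢ ∏_{i∉t} bᵢ`, `Finset.prod_add`).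

All statements are elementary. [folklore]

## Mathlib

Used: `SchwartzMap.postcompCLM`, `Complex.reCLM_norm`, `Complex.imCLM_norm`,
`Complex.ofRealCLM_norm`, `Complex.ofRealLI`, `ContinuousLinearMap.iteratedFDeriv_comp_left`,
`LinearIsometry.norm_compContinuousMultilinearMap`, `Seminorm.finset_sup_apply_le`,
`Finset.prod_add`, `Finset.prod_ite`. Searched and absent at the pin: real/imaginary part maps on
`SchwartzMap` (`reCLM`/`imCLM` with `SchwartzMap`: no hits).
-/

open scoped SchwartzMap ComplexConjugate
open Complex

noncomputable section

namespace Literature.MathematicalPhysics.QuantumLattice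

section ReIm

variable {X : Type*} [NormedAddCommGroup X] [NormedSpace ℝ X]

/-- The real part `x ↦ re (φ x)` of a complex test function, as a real test function
(`SchwartzMap.postcompCLM Complex.reCLM`). [folklore] -/
def reTest : 𝓢(X, ℂ) →L[ℝ] 𝓢(X, ℝ) :=
  SchwartzMap.postcompCLM Complex.reCLM

/-- The imaginary part `x ↦ im (φ x)` of a complex test function, as a real test function
(`SchwartzMap.postcompCLM Complex.imCLM`). [folklore] -/
def imTest : 𝓢(X, ℂ) →L[ℝ] 𝓢(X, ℝ) :=
  SchwartzMap.postcompCLM Complex.imCLM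

/-- `reTest φ x = re (φ x)`. [folklore] -/
@[simp]
theorem reTest_apply (φ : 𝓢(X, ℂ)) (x : X) : reTest φ x = (φ x).re := rfl

/-- `imTest φ x = im (φ x)`. [folklore] -/
@[simp]
theorem imTest_apply (φ : 𝓢(X, ℂ)) (x : X) : imTest φ x = (φ x).im := rfl

/-- The real part is supported inside the support of the function. [folklore] -/
theorem tsupport_reTest_subset (φ : 𝓢(X, ℂ)) :
    tsupport (reTest φ : X → ℝ) ⊆ tsupport (φ : X → ℂ) :=
  tsupport_comp_subset (g := fun z : ℂ => z.re) Complex.zero_re _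

/-- The imaginary part is supported inside the support of the function. [folklore] -/
theorem tsupport_imTest_subset (φ : 𝓢(X, ℂ)) :
    tsupport (imTest φ : X → ℝ) ⊆ tsupport (φ : X → ℂ) :=
  tsupport_comp_subset (g := fun z : ℂ => z.im) Complex.zero_im _

/-- A complex test function is recovered from its real and imaginary parts:
`φ x = re φ x + i im φ x`. [folklore] -/
theorem reTest_add_imTest_mul_I (φ : 𝓢(X, ℂ)) (x : X) :
    ((reTest φ x : ℝ) : ℂ) + ((imTest φ x : ℝ) : ℂ) * I = φ x := by
  simp [Complex.re_add_im]

/-- Postcomposition with a real-linear map `L : ℂ → ℂ` of operator norm `≤ 1` does not increase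
the Schwartz seminorms. [folklore] -/
theorem seminorm_postcomp_le_of_norm_le_one (L : ℂ →L[ℝ] ℂ) (hL : ‖L‖ ≤ 1) (φ : 𝓢(X, ℂ))
    (G : 𝓢(X, ℂ)) (hG : ∀ x, G x = L (φ x)) (a b : ℕ) :
    SchwartzMap.seminorm ℂ a b G ≤ SchwartzMap.seminorm ℂ a b φ := by
  refine SchwartzMap.seminorm_le_bound ℂ a b G (apply_nonneg _ _) fun x => ?_
  have hfun : (G : X → ℂ) = L ∘ φ := funext hG
  have hD : iteratedFDeriv ℝ b (G : X → ℂ) x = L.compContinuousMultilinearMap (iteratedFDeriv ℝ b φ x) := by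
    rw [hfun]
    exact L.iteratedFDeriv_comp_left ((φ.smooth ⊤).contDiffAt) (i := b) (mod_cast le_top)
  calc ‖x‖ ^ a * ‖iteratedFDeriv ℝ b (G : X → ℂ) x‖
      = ‖x‖ ^ a * ‖L.compContinuousMultilinearMap (iteratedFDeriv ℝ b φ x)‖ := by rw [hD]
    _ ≤ ‖x‖ ^ a * (‖L‖ * ‖iteratedFDeriv ℝ b φ x‖) := by
        gcongr
        exact L.norm_compContinuousMultilinearMap_le _
    _ ≤ ‖x‖ ^ a * (1 * ‖iteratedFDeriv ℝ b φ x‖) := by gcongr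
    _ = ‖x‖ ^ a * ‖iteratedFDeriv ℝ b φ x‖ := by rw [one_mul]
    _ ≤ SchwartzMap.seminorm ℂ a b φ := SchwartzMap.le_seminorm ℂ a b φ x

/-- The Schwartz norms of (the complexification of) the real part are bounded by those of the
function: `|re φ|_s ≤ |φ|_s`. [folklore] -/
theorem schwartzNorm_ofRealTest_reTest_le (s : ℕ) (φ : 𝓢(X, ℂ)) :
    schwartzNorm s (ofRealTest (reTest φ)) ≤ schwartzNorm s φ := by
  refine Seminorm.finset_sup_apply_le (schwartzNorm_nonneg s φ) fun i hi => ?_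
  obtain ⟨ha, hb⟩ : i.1 ≤ s ∧ i.2 ≤ s := by simpa [Prod.le_def] using Finset.mem_Iic.1 hi
  rw [SchwartzMap.schwartzSeminormFamily_apply]
  refine (seminorm_postcomp_le_of_norm_le_one (Complex.ofRealCLM.comp Complex.reCLM) ?_ φ _
    (fun x => rfl) i.1 i.2).trans (seminorm_le_schwartzNorm ha hb φ)
  refine (ContinuousLinearMap.opNorm_comp_le _ _).trans ?_
  rw [Complex.ofRealCLM_norm, Complex.reCLM_norm, one_mul]

/-- The Schwartz norms of (the complexification of) the imaginary part are bounded by those of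
the function: `|im φ|_s ≤ |φ|_s`. [folklore] -/
theorem schwartzNorm_ofRealTest_imTest_le (s : ℕ) (φ : 𝓢(X, ℂ)) :
    schwartzNorm s (ofRealTest (imTest φ)) ≤ schwartzNorm s φ := by
  refine Seminorm.finset_sup_apply_le (schwartzNorm_nonneg s φ) fun i hi => ?_
  obtain ⟨ha, hb⟩ : i.1 ≤ s ∧ i.2 ≤ s := by simpa [Prod.le_def] using Finset.mem_Iic.1 hi
  rw [SchwartzMap.schwartzSeminormFamily_apply]
  refine (seminorm_postcomp_le_of_norm_le_one (Complex.ofRealCLM.comp Complex.imCLM) ?_ φ _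
    (fun x => rfl) i.1 i.2).trans (seminorm_le_schwartzNorm ha hb φ)
  refine (ContinuousLinearMap.opNorm_comp_le _ _).trans ?_
  rw [Complex.ofRealCLM_norm, Complex.imCLM_norm, one_mul]

/-- The real Schwartz seminorms of a real test function agree with (are bounded by) the complex
seminorms of its complexification (`ofReal` is an isometry). [folklore] -/
theorem seminorm_le_seminorm_ofRealTest (a b : ℕ) (f : 𝓢(X, ℝ)) :
    SchwartzMap.seminorm ℝ a b f ≤ SchwartzMap.seminorm ℂ a b (ofRealTest f) := by
  refine SchwartzMap.seminorm_le_bound ℝ a b f (apply_nonneg _ _) fun x => ?_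
  have hfun : ((ofRealTest f : 𝓢(X, ℂ)) : X → ℂ) = Complex.ofRealLI.toContinuousLinearMap ∘ f := rfl
  have hD : iteratedFDeriv ℝ b ((ofRealTest f : 𝓢(X, ℂ)) : X → ℂ) x =
      Complex.ofRealLI.toContinuousLinearMap.compContinuousMultilinearMap (iteratedFDeriv ℝ b f x) := by
    rw [hfun]
    exact Complex.ofRealLI.toContinuousLinearMap.iteratedFDeriv_comp_left ((f.smooth ⊤).contDiffAt)
      (i := b) (mod_cast le_top)
  have hnorm : ‖iteratedFDeriv ℝ b f x‖ = ‖iteratedFDeriv ℝ b ((ofRealTest f : 𝓢(X, ℂ)) : X → ℂ) x‖ := by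
    rw [hD, LinearIsometry.norm_compContinuousMultilinearMap]
  rw [hnorm]
  exact SchwartzMap.le_seminorm ℂ a b _ x

/-- The finite family of real seminorms `sup_{a ≤ k} ‖·‖_{a,0}` controlling `Lᵖ` norms
(Mathlib `SchwartzMap.eLpNorm_le_seminorm`) is bounded by the Schwartz norm `|·|_k` of the
complexification. [folklore] -/
theorem sup_seminorm_le_schwartzNorm (k : ℕ) (f : 𝓢(X, ℝ)) :
    (Finset.Iic (k, 0)).sup (schwartzSeminormFamily ℝ X ℝ) f ≤ schwartzNorm k (ofRealTest f) := by
  refine Seminorm.finset_sup_apply_le (schwartzNorm_nonneg k _) fun i hi => ?_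
  obtain ⟨ha, hb⟩ : i.1 ≤ k ∧ i.2 ≤ 0 := by simpa [Prod.le_def] using Finset.mem_Iic.1 hi
  rw [SchwartzMap.schwartzSeminormFamily_apply]
  exact (seminorm_le_seminorm_ofRealTest i.1 i.2 f).trans
    (seminorm_le_schwartzNorm ha (hb.trans (Nat.zero_le k)) _)

/-- Homogeneity of the Schwartz norms under real scalars: `|r f|_s = |r| |f|_s`. [folklore] -/
theorem schwartzNorm_ofRealTest_smul (s : ℕ) (r : ℝ) (f : 𝓢(X, ℝ)) :
    schwartzNorm s (ofRealTest (r • f)) = |r| * schwartzNorm s (ofRealTest f) := by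
  have h : ofRealTest (r • f) = (r : ℂ) • ofRealTest f := by
    ext x
    simp [smul_apply]
  rw [h]
  unfold schwartzNorm
  rw [map_smul_eq_mul, Complex.norm_real, Real.norm_eq_abs]

/-- A real test function all of whose Schwartz norms `|f|_s` vanish is zero (already `|f|_s ≥
sup |f|`). [folklore] -/
theorem eq_zero_of_schwartzNorm_ofRealTest_eq_zero {s : ℕ} {f : 𝓢(X, ℝ)}
    (h : schwartzNorm s (ofRealTest f) = 0) : f = 0 := by
  ext x
  have hx := norm_le_schwartzNorm s (ofRealTest f) x
  rw [h, ofRealTest_apply, Complex.norm_real, norm_le_zero_iff] at hx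
  simpa using hx

end ReIm

/-! ### Complex tensor products as combinations of real ones -/

section Expansion

/-- Expansion of a complex tensor product into real ones: if `F = φ₁ ⊗ ⋯ ⊗ φₙ` then
`F = ∑_{t ⊆ [n]} i^{n - |t|} ⊗ᵢ ψᵗᵢ` with `ψᵗᵢ = re φᵢ` for `i ∈ t` and `im φᵢ` otherwise
(`∏ᵢ (aᵢ + i bᵢ) = ∑_t ∏_{i∈t} aᵢ ∏_{i∉t} i bᵢ`, `Finset.prod_add`). [folklore] -/
theorem eq_sum_tensorFin_reIm {E : Type*} [NormedAddCommGroup E] [NormedSpace ℝ E] {n : ℕ}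
    (φ : Fin n → 𝓢(E, ℂ)) (F : 𝓢((Fin n → E), ℂ)) (hF : IsTensorOf F φ) :
    F = ∑ t : Finset (Fin n), (I ^ (n - t.card)) •
      SchwartzMap.tensorFin n (fun i => ofRealTest (if i ∈ t then reTest (φ i) else imTest (φ i))) := by
  ext x
  rw [hF x]
  have hφ : ∀ i, φ i (x i) = ((reTest (φ i) (x i) : ℝ) : ℂ) + ((imTest (φ i) (x i) : ℝ) : ℂ) * I := by
    intro i
    simp [Complex.re_add_im]
  simp_rw [hφ]
  rw [Finset.prod_add]
  rw [show (∑ t : Finset (Fin n), (I ^ (n - t.card)) •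
      SchwartzMap.tensorFin n (fun i => ofRealTest (if i ∈ t then reTest (φ i) else imTest (φ i)))) x
      = ∑ t : Finset (Fin n), ((I ^ (n - t.card)) •
      SchwartzMap.tensorFin n (fun i => ofRealTest (if i ∈ t then reTest (φ i) else imTest (φ i)))) x
      from sum_apply _ _ _ |>.trans (by rfl)]
  rw [Finset.powerset_univ]
  refine Finset.sum_congr rfl fun t _ => ?_
  rw [smul_apply, smul_eq_mul, SchwartzMap.tensorFin_apply]
  have hsplit : ∏ i, (ofRealTest (if i ∈ t then reTest (φ i) else imTest (φ i))) (x i) =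
      (∏ i ∈ t, ((reTest (φ i) (x i) : ℝ) : ℂ)) * ∏ i ∈ Finset.univ \ t, ((imTest (φ i) (x i) : ℝ) : ℂ) := by
    have h := Finset.prod_ite (s := (Finset.univ : Finset (Fin n))) (p := fun i => i ∈ t)
      (f := fun i => ((reTest (φ i) (x i) : ℝ) : ℂ)) (g := fun i => ((imTest (φ i) (x i) : ℝ) : ℂ))
    simp only [Finset.filter_not, Finset.filter_mem_eq_inter, Finset.univ_inter] at h
    rw [← h]
    refine Finset.prod_congr rfl fun i _ => ?_
    split_ifs <;> simp
  rw [hsplit]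
  have hI : ∏ i ∈ Finset.univ \ t, ((imTest (φ i) (x i) : ℝ) : ℂ) * I =
      (∏ i ∈ Finset.univ \ t, ((imTest (φ i) (x i) : ℝ) : ℂ)) * I ^ (n - t.card) := by
    rw [Finset.prod_mul_distrib, Finset.prod_const, Finset.card_univ_sdiff, Fintype.card_fin]
  rw [hI]
  ring

end Expansion

end Literature.MathematicalPhysics.QuantumLattice
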